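import Summits.BirchSwinnertonDyer.Rank1Residual.GaloisImage.SupersingularNonsplitCartanNormalizer
import Literature.NumberTheory.EllipticCurves.OpenImageMazurTwistProofs
import Literature.NumberTheory.EllipticCurves.BSDInvariantsProofs
import Literature.NumberTheory.EllipticCurves.SelmerCorankProofs
import HarnessLib

/-!
# BSD rank-≤1 residual cell: a curve with a good SUPERSINGULAR quadratic twist at `p ≠ 2` and
# non-surjective `ρ̄_{E,p}` has image in the normaliser of a non-split Cartan subgroup
# (O8 ∩ (G-ss, `e = 2`): the additive rows of Kodaira type `I₀*` with supersingular twist)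

HONEST FRAMING (cell `b2b-bsdres-*`, run/shared/lean/b2b/bsd-rank1-residual/, verbatim): the goal
of the cell is to DELETE the COMBINATION-SHAPED residual classes for ALL analytic-rank `≤ 1` elliptic
curves over `ℚ` — "full BSD formula for every rank `≤ 1` curve in class C" assembled STRICTLY from
published theorems — so that the rank-`≤ 1` remainder becomes exactly the CONSTRUCTION-SHAPED
classes, which are TYPED (missing-input Props), NOT attempted; this is not "finishing BSD".
No claim beyond stated classes; census output = EVIDENCE, never a Literature fact.  Unit
`b2b-bsdres-n1011-p04-g2` (team n1011, O8 image strand, row T-O8c, sequel NEXT-1).  THEOREMS ONLY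
(no definition, no named fact); a TOOL file — no closure value, no class theorem, no label moves.

`SupersingularNonsplitCartanNormalizer.lean` (this unit, p251082): at a GOOD supersingular `p ≠ 2`
with `ρ̄_{E,p}` not onto, the image normalises the inertia non-split Cartan subgroup `kˣ`.  The O8
rows (`X4 ∧ ¬surj(p)`, ADDITIVE `p`) are not good at `p`; on the sub-cell "(G) ∧ ss, `e = 2`"
(cc-typer-5's `Additive.SubGss`: Kodaira `I₀*`, `E = V ⊗ χ_{p*}`, `V` good supersingular at `p`;
census `5Nn` ×73, `7Nn` ×11, `cells/n1011/O8-SUBPARTITION.md`) the representations of `E` and `V`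
agree up to the sign `χ_{p*}` (Silverman *AEC* X.5 Cor. 5.4) and `-1 ∈ kˣ`.  This file does that
transport for ANY quadratic twist datum (the cell's convention `C • W.quadraticTwist d = Wd`,
`d ≠ 0`, `Wd` globally minimal, as in `Additive/GordDescent*`, `SubGss.bsdp_iff_overC_of_bsdp_twist`):
§1 for `t : W₁[p] ≃+ W₂[p]` equivariant UP TO SIGN, a frame `(e₁, Φ₁)` of `W₁[p]` transports to a
frame `(e₁ ∘ t⁻¹, Φ₁ ∘ Ad(t⁻¹))` of `W₂[p]` (`frame_transport`) in which `Φ₂(ρ̄₂ σ) = ±Φ₁(ρ̄₁ σ)`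
(`apply_galoisRepTorsion_transport_eq_or_eq_neg`), so `G₁ ≤ H ⟹ G₂ ≤ H` for `H ∋ -1`
(`map_range_le_of_forall_eq_or_eq_neg`) and `G₁ = GL₂ ⟹ G₂ = GL₂` (`-1 = J²`,
`map_range_eq_top_of_forall_eq_or_eq_neg`); §2 the twist datum gives such a `t`
(`exists_torsion_addEquiv_signed_of_model_twist`: `exists_addEquiv_geomPoints_quadraticTwist_signed`
+ `geomPointsEquiv` + `torsionByEquiv`) and `Surj Wd p ↔ Surj W p` (`surj_iff_of_twist_datum`, a
light-import twin of additive-p2's `surj_iff_of_model_twist`); §3 **MAIN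
`exists_le_normalizer_unitGroup_of_goodSS_twist_of_not_surj`: if a quadratic twist model `Wd` of
`E` has `GoodSS Wd p`, `p ≠ 2`, and `ρ̄_{E,p}` is not onto, then in EVERY frame of `E[p]` the image
lies in `N(kˣ)` for a non-split Cartan subgroup `kˣ` and not in `kˣ`** (complex conjugation), and
(`not_le_normalizer_splitCartan_of_goodSS_twist`) in NO split-Cartan normaliser whatever the image
(so BPR 2013 / BDMTV 2019 are vacuous on these rows); `nonsplit_dihedral_of_goodSS_twist_of_not_surj`
bundles both.  NOT claimed: that the image of `E` contains `kˣ`; any bound on `p` (Serre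
uniformity); anything on the defect-`3/4/6` or wild rows; any class theorem; no supply theorem
`SubGss → GoodSS Wd p` is in the tree yet (the hypothesis is the twist DATUM).

References: [Serre1972] J.-P. Serre, Invent. Math. 15 (1972) §1.11 Prop. 12, §2.2 Prop. 14, §2.7
Prop. 17, §5.2 (iv); [SilvermanAEC2009] *AEC* X.5 Cor. 5.4, X.2 Prop. 2.4, III.6.4(b).
-/

noncomputable section

open scoped Classical
open Field Matrix WeierstrassCurve Literature.NumberTheory.EllipticCurves
  Literature.NumberTheory.GaloisRepresentations Literature.NumberTheory.GaloisRepresentations.Serre1972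
  Literature.NumberTheory.EllipticCurves.Rank1Residual

namespace Summit.BirchSwinnertonDyer.Rank1Residual.GaloisImage

/-! ### §1 Frames transported along a sign-equivariant isomorphism of torsion modules -/
section Transport

variable (p : ℕ) [hp : Fact p.Prime] {W₁ W₂ : WeierstrassCurve ℚ}
  (t : geomTorsion W₁ p ≃+ geomTorsion W₂ p)
  (Φ₁ : Multiplicative (AddAut (geomTorsion W₁ p)) ≃* GL (Fin 2) (ZMod p))
  (e₁ : geomTorsion W₁ p ≃+ (Fin 2 → ZMod p))
  (he₁ : ∀ (g : Multiplicative (AddAut (geomTorsion W₁ p))) (x : geomTorsion W₁ p),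
    e₁ (Multiplicative.toAdd g x) =
      ((Φ₁ g : GL (Fin 2) (ZMod p)) : Matrix (Fin 2) (Fin 2) (ZMod p)) *ᵥ e₁ x)

include he₁ in
/-- **Transport of a frame along an additive isomorphism `t : W₁[p] ≃+ W₂[p]`.**  If `(e₁, Φ₁)` is a
frame of `W₁[p]` (`e₁(g x) = Φ₁(g) · e₁(x)`), then `e₂ = e₁ ∘ t⁻¹` and `Φ₂ = Φ₁ ∘ Ad(t⁻¹)`
(`Φ₂(g) = Φ₁(t⁻¹ g t)`, Mathlib's `AddAut.congr`) form a frame of `W₂[p]`. [folklore] -/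
theorem frame_transport :
    ∀ (g : Multiplicative (AddAut (geomTorsion W₂ p))) (x : geomTorsion W₂ p),
      (t.symm.trans e₁) (Multiplicative.toAdd g x) =
        ((((AddEquiv.toMultiplicative (AddAut.congr t.symm)).trans Φ₁) g : GL (Fin 2) (ZMod p)) :
          Matrix (Fin 2) (Fin 2) (ZMod p)) *ᵥ (t.symm.trans e₁) x := by
  intro g x
  have h := he₁ (Multiplicative.ofAdd (AddAut.congr t.symm (Multiplicative.toAdd g))) (t.symm x)
  have h1 : Multiplicative.toAdd
      (Multiplicative.ofAdd (AddAut.congr t.symm (Multiplicative.toAdd g))) (t.symm x) =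
        t.symm (Multiplicative.toAdd g x) := by
    rw [toAdd_ofAdd]
    show t.symm ((Multiplicative.toAdd g) (t (t.symm x))) = _
    rw [t.apply_symm_apply]
  rw [h1] at h
  exact h

include he₁ in
/-- **`ρ̄₂ = ρ̄₁ ⊗ (sign)` in matrices.**  If `t : W₁[p] ≃+ W₂[p]` is `Γ_ℚ`-equivariant UP TO SIGN
(for each `σ`, `t(σx) = σ t(x)` for all `x` or `t(σx) = -σ t(x)` for all `x` — the twisting
isomorphism of a quadratic twist, Silverman *AEC* X.2 Prop. 2.4), then in the transported frame
`Φ₂(ρ̄_{W₂,p} σ) = Φ₁(ρ̄_{W₁,p} σ)` or `= -Φ₁(ρ̄_{W₁,p} σ)`.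
[cite: SilvermanAEC2009, X.5 Cor. 5.4 and X.2 Prop. 2.4] -/
theorem apply_galoisRepTorsion_transport_eq_or_eq_neg
    (ht : ∀ σ : absoluteGaloisGroup ℚ,
      (∀ x, t (σ • x) = σ • t x) ∨ (∀ x, t (σ • x) = -(σ • t x)))
    (σ : absoluteGaloisGroup ℚ) :
    ((AddEquiv.toMultiplicative (AddAut.congr t.symm)).trans Φ₁) (galoisRepTorsion W₂ p σ) =
        Φ₁ (galoisRepTorsion W₁ p σ) ∨
      ((AddEquiv.toMultiplicative (AddAut.congr t.symm)).trans Φ₁) (galoisRepTorsion W₂ p σ) =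
        -Φ₁ (galoisRepTorsion W₁ p σ) := by
  set Φ₂ := (AddEquiv.toMultiplicative (AddAut.congr t.symm)).trans Φ₁ with hΦ₂
  have he₂ := frame_transport p t Φ₁ e₁ he₁
  -- the matrix of `σ` on `W₂[p]` against the vector `e₁ (t⁻¹ x')`
  have key : ∀ x' : geomTorsion W₂ p,
      ((Φ₂ (galoisRepTorsion W₂ p σ) : GL (Fin 2) (ZMod p)) : Matrix (Fin 2) (Fin 2) (ZMod p)) *ᵥ
        e₁ (t.symm x') = e₁ (t.symm (σ • x')) := fun x' ↦ by
    have h := he₂ (galoisRepTorsion W₂ p σ) x'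
    rw [galoisRepTorsion_apply] at h
    exact h.symm
  -- the matrix of `σ` on `W₁[p]` against the same vector
  have key₁ : ∀ x' : geomTorsion W₂ p,
      ((Φ₁ (galoisRepTorsion W₁ p σ) : GL (Fin 2) (ZMod p)) : Matrix (Fin 2) (Fin 2) (ZMod p)) *ᵥ
        e₁ (t.symm x') = e₁ (σ • t.symm x') := fun x' ↦ by
    rw [← galoisRepTorsion_apply W₁ p σ (t.symm x'), he₁]
  have hsurj : ∀ v : Fin 2 → ZMod p, ∃ x' : geomTorsion W₂ p, e₁ (t.symm x') = v := fun v ↦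
    ⟨t (e₁.symm v), by rw [t.symm_apply_apply, e₁.apply_symm_apply]⟩
  rcases ht σ with hs | hs
  · left
    apply Units.ext
    apply Matrix.mulVec_injective
    funext v
    obtain ⟨x', rfl⟩ := hsurj v
    rw [key, key₁]
    congr 1
    apply t.injective
    rw [t.apply_symm_apply, hs, t.apply_symm_apply]
  · right
    apply Units.ext
    apply Matrix.mulVec_injective
    funext v
    obtain ⟨x', rfl⟩ := hsurj v
    rw [key, Units.val_neg, Matrix.neg_mulVec, key₁, ← map_neg]
    congr 1
    apply t.injective
    rw [t.apply_symm_apply, map_neg, hs, t.apply_symm_apply, neg_neg]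

/-- The relation "`Φ₂(ρ̄₂ σ) = ±Φ₁(ρ̄₁ σ)` for all `σ`" is symmetric in the two curves. [folklore] -/
theorem forall_eq_or_eq_neg_symm
    {Φ₂ : Multiplicative (AddAut (geomTorsion W₂ p)) ≃* GL (Fin 2) (ZMod p)}
    (hrel : ∀ σ : absoluteGaloisGroup ℚ,
      Φ₂ (galoisRepTorsion W₂ p σ) = Φ₁ (galoisRepTorsion W₁ p σ) ∨
        Φ₂ (galoisRepTorsion W₂ p σ) = -Φ₁ (galoisRepTorsion W₁ p σ)) :
    ∀ σ : absoluteGaloisGroup ℚ,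
      Φ₁ (galoisRepTorsion W₁ p σ) = Φ₂ (galoisRepTorsion W₂ p σ) ∨
        Φ₁ (galoisRepTorsion W₁ p σ) = -Φ₂ (galoisRepTorsion W₂ p σ) := by
  intro σ
  rcases hrel σ with h | h
  · exact Or.inl h.symm
  · exact Or.inr (by rw [h, neg_neg])

/-- **Images up to sign: `G₁ ≤ H ⟹ G₂ ≤ H` whenever `-1 ∈ H`** (`Gᵢ = Φᵢ(ρ̄_{Wᵢ,p}(Γ_ℚ))`,
`Φ₂(ρ̄₂ σ) = ±Φ₁(ρ̄₁ σ)`). [folklore] -/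
theorem map_range_le_of_forall_eq_or_eq_neg
    {Φ₂ : Multiplicative (AddAut (geomTorsion W₂ p)) ≃* GL (Fin 2) (ZMod p)}
    (hrel : ∀ σ : absoluteGaloisGroup ℚ,
      Φ₂ (galoisRepTorsion W₂ p σ) = Φ₁ (galoisRepTorsion W₁ p σ) ∨
        Φ₂ (galoisRepTorsion W₂ p σ) = -Φ₁ (galoisRepTorsion W₁ p σ))
    {H : Subgroup (GL (Fin 2) (ZMod p))} (hH : -1 ∈ H)
    (hle : (galoisRepTorsion W₁ p).range.map Φ₁.toMonoidHom ≤ H) :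
    (galoisRepTorsion W₂ p).range.map Φ₂.toMonoidHom ≤ H := by
  intro g hg
  obtain ⟨σ, rfl⟩ := (mem_map_range_galoisRepTorsion_iff W₂ p Φ₂).mp hg
  have h1 : Φ₁ (galoisRepTorsion W₁ p σ) ∈ H :=
    hle (apply_galoisRepTorsion_mem_map_range W₁ p Φ₁ σ)
  rcases hrel σ with h | h
  · rw [h]; exact h1
  · rw [h, ← neg_one_mul]; exact H.mul_mem hH h1

/-- **Surjectivity is a twist invariant, matrix form: `G₁ = GL₂(𝔽_p) ⟹ G₂ = GL₂(𝔽_p)`** when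
`Φ₂(ρ̄₂ σ) = ±Φ₁(ρ̄₁ σ)`: `-1 = J²`, `J = (0 -1; 1 0)`, lies in `G₂`, and every `g` has `±g ∈ G₂`
(cf. the tree's `twistAdmissible_hasSurjectiveModNGaloisRep_of_addEquiv_signed`). [cite: Serre1972, §4] -/
theorem map_range_eq_top_of_forall_eq_or_eq_neg
    {Φ₂ : Multiplicative (AddAut (geomTorsion W₂ p)) ≃* GL (Fin 2) (ZMod p)}
    (hrel : ∀ σ : absoluteGaloisGroup ℚ,
      Φ₂ (galoisRepTorsion W₂ p σ) = Φ₁ (galoisRepTorsion W₁ p σ) ∨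
        Φ₂ (galoisRepTorsion W₂ p σ) = -Φ₁ (galoisRepTorsion W₁ p σ))
    (htop : (galoisRepTorsion W₁ p).range.map Φ₁.toMonoidHom = ⊤) :
    (galoisRepTorsion W₂ p).range.map Φ₂.toMonoidHom = ⊤ := by
  set G₂ := (galoisRepTorsion W₂ p).range.map Φ₂.toMonoidHom with hG₂
  -- every `g` has `g ∈ G₂` or `-g ∈ G₂`
  have hpm : ∀ g : GL (Fin 2) (ZMod p), g ∈ G₂ ∨ -g ∈ G₂ := by
    intro g
    have hg : g ∈ (galoisRepTorsion W₁ p).range.map Φ₁.toMonoidHom := htop ▸ Subgroup.mem_top g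
    obtain ⟨σ, hσ⟩ := (mem_map_range_galoisRepTorsion_iff W₁ p Φ₁).mp hg
    have hmem : Φ₂ (galoisRepTorsion W₂ p σ) ∈ G₂ := apply_galoisRepTorsion_mem_map_range W₂ p Φ₂ σ
    rcases hrel σ with h | h
    · exact Or.inl (by rw [← hσ, ← h]; exact hmem)
    · exact Or.inr (by rw [← hσ, ← h]; exact hmem)
  -- `-1 = J²` lies in `G₂`
  have hJdet : Matrix.det !![(0 : ZMod p), -1; 1, 0] ≠ 0 := by
    rw [Matrix.det_fin_two_of]; simp
  set J : GL (Fin 2) (ZMod p) := Matrix.GeneralLinearGroup.mkOfDetNeZero _ hJdet with hJ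
  have hJJ : J * J = -1 := by
    apply Units.ext
    rw [Units.val_mul, Units.val_neg, Units.val_one, hJ]
    ext i j
    fin_cases i <;> fin_cases j <;>
      simp [Matrix.GeneralLinearGroup.mkOfDetNeZero, Matrix.mul_apply, Fin.sum_univ_two]
  have hneg1 : (-1 : GL (Fin 2) (ZMod p)) ∈ G₂ := by
    rcases hpm J with h | h
    · rw [← hJJ]; exact G₂.mul_mem h h
    · have : (-J) * (-J) = -1 := by rw [neg_mul_neg, hJJ]
      rw [← this]; exact G₂.mul_mem h h
  refine (Subgroup.eq_top_iff' G₂).mpr fun g ↦ ?_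
  rcases hpm g with h | h
  · exact h
  · have : g = -1 * -g := by rw [neg_one_mul, neg_neg]
    rw [this]; exact G₂.mul_mem hneg1 h

end Transport

/-! ### §2 The twist datum: a sign-equivariant isomorphism `E[p] ≃+ E^{(d)}[p]` -/
section Twist

variable (W : WeierstrassCurve ℚ) [W.IsElliptic] (p : ℕ) [hp : Fact p.Prime]
  (Φ : Multiplicative (AddAut (geomTorsion W p)) ≃* GL (Fin 2) (ZMod p))
  (e : geomTorsion W p ≃+ (Fin 2 → ZMod p))
  (he : ∀ (g : Multiplicative (AddAut (geomTorsion W p))) (x : geomTorsion W p),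
    e (Multiplicative.toAdd g x) =
      ((Φ g : GL (Fin 2) (ZMod p)) : Matrix (Fin 2) (Fin 2) (ZMod p)) *ᵥ e x)
  {d : ℚ} (Wd : WeierstrassCurve ℚ)

omit [W.IsElliptic] hp in
/-- **The twisting isomorphism on `p`-torsion, for any `ℚ`-model of the twist.**  If
`C • W.quadraticTwist d = Wd` (`d ≠ 0`) there is an additive isomorphism `t : W[p] ≃+ Wd[p]` which is
`Γ_ℚ`-equivariant up to sign: for each `σ`, `t(σx) = σ t(x)` for all `x` or `t(σx) = -σ t(x)` for all
`x` (the sign is `χ_d(σ) = σ√d/√d`).  Assembled from the tree's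
`exists_addEquiv_geomPoints_quadraticTwist_signed` (*AEC* X.5 Cor. 5.4), the `Γ_ℚ`-equivariant
change of variables `geomPointsEquiv` and the restriction to torsion `torsionByEquiv`.
[cite: SilvermanAEC2009, X.5 Cor. 5.4 and X.2 Prop. 2.4] -/
theorem exists_torsion_addEquiv_signed_of_model_twist (hd : d ≠ 0)
    (hWd : ∃ C : VariableChange ℚ, C • W.quadraticTwist d = Wd) :
    ∃ t : geomTorsion W p ≃+ geomTorsion Wd p, ∀ σ : absoluteGaloisGroup ℚ,
      (∀ x, t (σ • x) = σ • t x) ∨ (∀ x, t (σ • x) = -(σ • t x)) := by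
  haveI : NeZero (2 : ℚ) := ⟨two_ne_zero⟩
  obtain ⟨C, rfl⟩ := hWd
  obtain ⟨f, hf⟩ := W.exists_addEquiv_geomPoints_quadraticTwist_signed hd
  let g : geomPoints (W.quadraticTwist d) ≃+ geomPoints (C • W.quadraticTwist d) :=
    geomPointsEquiv (W.quadraticTwist d) C
  let h : geomPoints W ≃+ geomPoints (C • W.quadraticTwist d) := f.symm.trans g
  have hg : ∀ (σ : absoluteGaloisGroup ℚ) (P : geomPoints (W.quadraticTwist d)),
      g (σ • P) = σ • g P := fun σ P ↦ geomPointsEquiv_smul (W.quadraticTwist d) C σ P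
  have hh : ∀ σ : absoluteGaloisGroup ℚ,
      (∀ P, h (σ • P) = σ • h P) ∨ (∀ P, h (σ • P) = -(σ • h P)) := by
    intro σ
    rcases hf σ with hs | hs
    · left
      intro P
      show g (f.symm (σ • P)) = σ • g (f.symm P)
      rw [← hg]
      congr 1
      apply f.injective
      rw [hs, f.apply_symm_apply, f.apply_symm_apply]
    · right
      intro P
      show g (f.symm (σ • P)) = -(σ • g (f.symm P))
      rw [← hg, ← map_neg]
      congr 1
      apply f.injective
      rw [map_neg, hs, f.apply_symm_apply, f.apply_symm_apply, neg_neg]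
  have hcoe : ∀ x : geomTorsion W p,
      ((torsionByEquiv h p x : geomTorsion (C • W.quadraticTwist d) p) :
        geomPoints (C • W.quadraticTwist d)) = h x := fun _ ↦ rfl
  refine ⟨torsionByEquiv h p, fun σ ↦ ?_⟩
  rcases hh σ with hs | hs
  · left
    intro x
    apply Subtype.ext
    rw [hcoe, AddSubgroup.torsionBy.coe_smul, hs, AddSubgroup.torsionBy.coe_smul, hcoe]
  · right
    intro x
    apply Subtype.ext
    rw [hcoe, AddSubgroup.torsionBy.coe_smul, hs, AddSubgroup.coe_neg,
      AddSubgroup.torsionBy.coe_smul, hcoe]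

/-- **`Surj Wd p ↔ Surj W p` for any model `Wd` of a quadratic twist `E^{(d)}`, `d ≠ 0`** —
light-import twin of additive-p2's `Additive.surj_iff_of_model_twist` (there via
`twistAdmissible_hasSurjectiveModNGaloisRep_of_addEquiv_signed`; here via frames,
`map_range_eq_top_of_forall_eq_or_eq_neg`, frames existing by `exists_frame_galoisRepTorsion_rat`).
[cite: SilvermanAEC2009, X.5 Cor. 5.4] -/
theorem surj_iff_of_twist_datum [Wd.IsElliptic] (hd : d ≠ 0)
    (hWd : ∃ C : VariableChange ℚ, C • W.quadraticTwist d = Wd) : Surj Wd p ↔ Surj W p := by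
  obtain ⟨t, ht⟩ := exists_torsion_addEquiv_signed_of_model_twist W p Wd hd hWd
  obtain ⟨e₁, Φ₁, he₁, -⟩ := exists_frame_galoisRepTorsion_rat W p
  have hrel := apply_galoisRepTorsion_transport_eq_or_eq_neg p t Φ₁ e₁ he₁ ht
  set Φ₂ := (AddEquiv.toMultiplicative (AddAut.congr t.symm)).trans Φ₁ with hΦ₂
  constructor
  · intro h
    have htop : (galoisRepTorsion Wd p).range.map Φ₂.toMonoidHom = ⊤ :=
      (map_range_galoisRepTorsion_eq_top_iff Wd p Φ₂).mpr h
    exact (map_range_galoisRepTorsion_eq_top_iff W p Φ₁).mp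
      (map_range_eq_top_of_forall_eq_or_eq_neg p Φ₂ (forall_eq_or_eq_neg_symm p Φ₁ hrel) htop)
  · intro h
    have htop : (galoisRepTorsion W p).range.map Φ₁.toMonoidHom = ⊤ :=
      (map_range_galoisRepTorsion_eq_top_iff W p Φ₁).mpr h
    exact (map_range_galoisRepTorsion_eq_top_iff Wd p Φ₂).mp
      (map_range_eq_top_of_forall_eq_or_eq_neg p Φ₁ hrel htop)

/-! ### §3 The transport of the supersingular shape theorem -/

variable [Wd.IsElliptic] [Wd.IsGloballyMinimal]

include he in
/-- **MAIN — a curve with a good SUPERSINGULAR quadratic twist at `p ≠ 2` and non-surjective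
`ρ̄_{E,p}` normalises a non-split Cartan subgroup.**  Let `E = W/ℚ`, `d ≠ 0`, `Wd` a globally
minimal model of `E^{(d)}` (`C • W.quadraticTwist d = Wd`) with `GoodSS Wd p`, `p` odd, and
`ρ̄_{E,p}` not onto.  Then for every frame `Φ` of `E[p]` some subalgebra `k ⊆ M₂(𝔽_p)`, a field
of degree `2`, has `Φ(ρ̄_{E,p}(Γ_ℚ)) ≤ N(kˣ)` and `⊄ kˣ`.  Proof: `ρ̄_{E^{(d)},p}` is not onto
(`surj_iff_of_twist_datum`); `exists_le_normalizer_unitGroup_of_goodSS_of_not_surj` (p251082, Serre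
Prop. 12 + 17 + 14) in the transported frame; the two images agree up to sign and `-1 ∈ kˣ`
(`map_range_le_of_forall_eq_or_eq_neg`); `⊄ kˣ` by complex conjugation (`not_le_unitGroup_of_mem`).
Intended rows: O8 ∩ (G) ∧ ss, `e = 2` (census `5Nn`/`7Nn`) and X7-type twists; STRUCTURE ONLY, no
bound on `p`. [cite: Serre1972, §1.11 Prop. 12, §2.7 Prop. 17, §2.2 Prop. 14, §5.2 (iv)]
[cite: SilvermanAEC2009, X.5 Cor. 5.4] -/
theorem exists_le_normalizer_unitGroup_of_goodSS_twist_of_not_surj (hp2 : p ≠ 2) (hd : d ≠ 0)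
    (hWd : ∃ C : VariableChange ℚ, C • W.quadraticTwist d = Wd) (hss : GoodSS Wd p)
    (hns : ¬ Surj W p) :
    ∃ k : Subalgebra (ZMod p) (Matrix (Fin 2) (Fin 2) (ZMod p)), IsField k ∧
      Module.finrank (ZMod p) k = 2 ∧
      (galoisRepTorsion W p).range.map Φ.toMonoidHom ≤
          Subgroup.normalizer (unitGroup k : Set (GL (Fin 2) (ZMod p))) ∧
        ¬ (galoisRepTorsion W p).range.map Φ.toMonoidHom ≤ unitGroup k := by
  obtain ⟨t, ht⟩ := exists_torsion_addEquiv_signed_of_model_twist W p Wd hd hWd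
  set Φd := (AddEquiv.toMultiplicative (AddAut.congr t.symm)).trans Φ with hΦd
  have hed := frame_transport p t Φ e he
  have hrel := apply_galoisRepTorsion_transport_eq_or_eq_neg p t Φ e he ht
  have hnsd : ¬ Surj Wd p := fun h ↦ hns ((surj_iff_of_twist_datum W p Wd hd hWd).mp h)
  obtain ⟨k, hk, h2, -, hGN, -⟩ :=
    exists_le_normalizer_unitGroup_of_goodSS_of_not_surj Wd p Φd (t.symm.trans e) hed hp2 hss hnsd
  refine ⟨k, hk, h2, ?_, ?_⟩
  · -- `-1 ∈ kˣ ≤ N(kˣ)`, and the two images agree up to sign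
    have hneg1 : (-1 : GL (Fin 2) (ZMod p)) ∈
        Subgroup.normalizer (unitGroup k : Set (GL (Fin 2) (ZMod p))) := by
      apply Subgroup.le_normalizer
      rw [mem_unitGroup_iff, Units.val_neg, Units.val_one]
      exact k.neg_mem k.one_mem
    exact map_range_le_of_forall_eq_or_eq_neg p Φd (forall_eq_or_eq_neg_symm p Φ hrel) hneg1 hGN
  · obtain ⟨c, hcG, hcc, hcdet⟩ := exists_conj_mem_map_range W p Φ e he
    exact not_le_unitGroup_of_mem (DeligneSerre1974.two_ne_zero_of_ne_two hp2) hk hcG hcc hcdet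

omit [W.IsElliptic] in
include he in
/-- **No split-Cartan normaliser for a curve with a good supersingular twist at `p ≠ 2`** (any
image, onto or not): if `Φ(ρ̄_{E,p}(Γ_ℚ)) ≤ N(P (* 0; 0 *) P⁻¹)` then, the images of `E` and
`E^{(d)}` agreeing up to sign and `-1` being diagonal, the twist's image would lie there too —
impossible at a good supersingular prime (`not_le_normalizer_splitCartan_of_goodSS`, Prop. 14).  So
on the O8 sub-cell (G) ∧ ss the image types `pNs`/`pCs` never occur and BPR 2013 / BDMTV 2019 are
vacuous. [cite: Serre1972, §2.2 Prop. 14] -/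
theorem not_le_normalizer_splitCartan_of_goodSS_twist (hp2 : p ≠ 2) (hd : d ≠ 0)
    (hWd : ∃ C : VariableChange ℚ, C • W.quadraticTwist d = Wd) (hss : GoodSS Wd p)
    (P : GL (Fin 2) (ZMod p)) :
    ¬ (galoisRepTorsion W p).range.map Φ.toMonoidHom ≤
        Subgroup.normalizer (splitCartan P : Set (GL (Fin 2) (ZMod p))) := by
  intro hle
  obtain ⟨t, ht⟩ := exists_torsion_addEquiv_signed_of_model_twist W p Wd hd hWd
  set Φd := (AddEquiv.toMultiplicative (AddAut.congr t.symm)).trans Φ with hΦd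
  have hrel := apply_galoisRepTorsion_transport_eq_or_eq_neg p t Φ e he ht
  have hP1 : (P⁻¹ * -1 * P : GL (Fin 2) (ZMod p)) = -1 := by
    rw [mul_neg_one, neg_mul, inv_mul_cancel]
  have hneg1 : (-1 : GL (Fin 2) (ZMod p)) ∈
      Subgroup.normalizer (splitCartan P : Set (GL (Fin 2) (ZMod p))) := by
    apply Subgroup.le_normalizer
    rw [mem_splitCartan_iff, hP1, Units.val_neg, Units.val_one]
    exact ⟨by simp, by simp⟩
  have hled : (galoisRepTorsion Wd p).range.map Φd.toMonoidHom ≤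
      Subgroup.normalizer (splitCartan P : Set (GL (Fin 2) (ZMod p))) :=
    map_range_le_of_forall_eq_or_eq_neg p Φ hrel hneg1 hle
  exact not_le_normalizer_splitCartan_of_goodSS Wd p Φd hp2 hss P hled

include he in
/-- **Frame-free summary for the twist rows.**  If `E = W/ℚ` has a quadratic twist model `Wd`
(`C • W.quadraticTwist d = Wd`, `d ≠ 0`, globally minimal) with good supersingular reduction at
`p ≠ 2` and `ρ̄_{E,p}` is not onto, then — `(e, Φ)` being any frame of `E[p]`, and frames exist
(`exists_frame_galoisRepTorsion_rat`) — the image of `ρ̄_{E,p}` is contained in the normaliser of a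
non-split Cartan subgroup of `GL₂(𝔽_p)` and not in the Cartan subgroup, and in no split-Cartan
normaliser. [cite: Serre1972, §1.11 Prop. 12, §2.7 Prop. 17, §2.2 Prop. 14]
[cite: SilvermanAEC2009, X.5 Cor. 5.4] -/
theorem nonsplit_dihedral_of_goodSS_twist_of_not_surj (hp2 : p ≠ 2) (hd : d ≠ 0)
    (hWd : ∃ C : VariableChange ℚ, C • W.quadraticTwist d = Wd) (hss : GoodSS Wd p)
    (hns : ¬ Surj W p) :
    (∃ k : Subalgebra (ZMod p) (Matrix (Fin 2) (Fin 2) (ZMod p)), IsField k ∧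
      Module.finrank (ZMod p) k = 2 ∧
      (galoisRepTorsion W p).range.map Φ.toMonoidHom ≤
          Subgroup.normalizer (unitGroup k : Set (GL (Fin 2) (ZMod p))) ∧
        ¬ (galoisRepTorsion W p).range.map Φ.toMonoidHom ≤ unitGroup k) ∧
    ∀ P : GL (Fin 2) (ZMod p), ¬ (galoisRepTorsion W p).range.map Φ.toMonoidHom ≤
        Subgroup.normalizer (splitCartan P : Set (GL (Fin 2) (ZMod p))) :=
  ⟨exists_le_normalizer_unitGroup_of_goodSS_twist_of_not_surj W p Φ e he Wd hp2 hd hWd hss hns,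
    fun P ↦ not_le_normalizer_splitCartan_of_goodSS_twist W p Φ e he Wd hp2 hd hWd hss P⟩

end Twist

end Summit.BirchSwinnertonDyer.Rank1Residual.GaloisImage

end
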